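import Summits.ResolutionOfSingularities.ResolutionOfSingularities.Theorems.FrobeniusLadderFInjectiveMacaulayficationTauFloorP2d5CYChartNotFull
import Summits.ResolutionOfSingularities.ResolutionOfSingularities.Theorems.FrobeniusLadderFInjectiveMacaulayficationTauFloorP2d5CChartSymmetry
import Summits.ResolutionOfSingularities.ResolutionOfSingularities.Theorems.FrobeniusLadderFInjectiveMacaulayficationLocalBlowupBadFibreFromCharts
import HarnessLib

/-!
# (O-1″-Y) EVERY prime over the vertex of the charts `D(ȳ)`, `D(ū)`, `D(t̄)`, `D(s̄)` of `Bl_τ(P2d5C)` is NON-FULL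
# (crux `FInjectiveMacaulayfication` stmt-ResolutionOfSingularities-15315, chain w45a; (O-1″) «the whole closed fibre of the P2d5C τ-floor is non-FULL», charts `D(ȳ)` and,
# by the `S₄`-symmetry, `D(ū)`, `D(t̄)`, `D(s̄)`; sequel of this seat's p640726 `…TauFloorP2d5CYChartNotFull` §3; seat res-L1-w45a-stub-1 g11)

[OURS · L1 W4.5a] Support file (`--supports stmt-ResolutionOfSingularities-15315 --as helper`); replaces the role of NO printed item; NOT a statement of any
manuscript; def-free; UNCONDITIONAL; `CharP k 2` throughout (clause transport along generizations). AI-written (AI review is weaker than expert review).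

SETTING: `A₀ = k[X0..X5]/(f)`, `f = X5² + X0⁴X5 + X1³ + X2³ + X3³ + X4³`, `v` the vertex, `τ = Ideal.span {x̄², ȳ, ū, t̄, s̄, z̄}`; `T₂ = k[y, w, u′, t′, s′][x̄][z̄′]` the
`D(ȳ)` chart (`TauFloorP2d5CYChartAlgebra`), `T₂ ≃+* blowupAlgebra τ ȳ` (`TauFloorP2d5CYChartIdent.exists_chartEquiv`).
* §1 `mem_of_X0_mem` (`ȳ ∈ P ⇒ x̄, z̄′ ∈ P`: `x̄² = ȳw̄`, `z̄′² = −ȳ(…)`), ★★ `not_fullCl_localization_of_mem` — every prime `P ∋ ȳ` of `T₂` has a NON-FULL local ring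
  (p640726's `not_fullCl_stalk_of_mem` at the point `P`, via `Spec.stalkIso`);
* §2 ★★ `not_fullCl_localization_blowupAlgebra_over` — every prime `Q` of `A₀[τ/ȳ]` with `𝔪_v ≤ Q ∩ A₀` is NON-FULL (transport along the chart equivalence);
* §3 `map_vertex_le_of_swap`, ★★ `not_fullCl_localization_blowupAlgebra_over_of_swap` — the same for `A₀[τ/x̄_j]`, `j ∈ {2, 3, 4}` (= `D(ū)`, `D(t̄)`, `D(s̄)`): the
  automorphism `σ̄ = (X₁ ↔ X_j)` of `A₀` maps `𝔪_v` into itself and induces `A₀[τ/ȳ] ≃+* A₀[τ/x̄_j]` over `σ̄` (`TauFloorOneChartSymmetry.exists_blowupAlgebra_congr'`),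
  so primes over `v` correspond (`LocalBlowupBadFibreFromCharts.not_fullCl_localization_of_ringEquiv`).
[cite: GortzWedhorn2020, (13.19)] [cite: Fedder1983, Prop. 1.7 (context)]
-/

-- single-problem summit: the doubled namespace component is forced
set_option linter.dupNamespace false

noncomputable section

namespace Summit.ResolutionOfSingularities.ResolutionOfSingularities.Theorems.FInjectiveMacaulayfication.TauFloorP2d5CYChartBadFibre

open MvPolynomial IsLocalization AlgebraicGeometry CategoryTheory Literature.AlgebraicGeometry.Resolution
open Summit.ResolutionOfSingularities.ResolutionOfSingularities.Theorems.FInjectiveMacaulayfication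
open SliceableCentre TauFloorP2d5CYChartAlgebra

variable (k : Type) [Field k]

/-! ## §1 Every prime `P ∋ ȳ` of `T₂` is NON-FULL -/

/-- `ȳ ∈ P` forces `x̄ ∈ P` (`x̄² = ȳw̄`) and `z̄′ ∈ P` (`z̄′² = −ȳ(w̄²z̄′ + 1 + Σ′)`). [plumbing] -/
theorem mem_of_X0_mem (h₁ : Polynomial (MvPolynomial (Fin 5) k)) (hh₁ : h₁ = Polynomial.X ^ 2 - Polynomial.C (X 0 * X 1))
    (h₂ : Polynomial (AdjoinRoot h₁))
    (hh₂ : h₂ = Polynomial.X ^ 2 + (Polynomial.C (algebraMap (MvPolynomial (Fin 5) k) (AdjoinRoot h₁) (X 0 * X 1 ^ 2)) * Polynomial.X +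
      Polynomial.C (algebraMap (MvPolynomial (Fin 5) k) (AdjoinRoot h₁) (X 0 * (1 + X 2 ^ 3 + X 3 ^ 3 + X 4 ^ 3)))))
    (P : Ideal (AdjoinRoot h₂)) [hP : P.IsPrime] (hy : algebraMap (MvPolynomial (Fin 5) k) (AdjoinRoot h₂) (X 0) ∈ P) :
    AdjoinRoot.of h₂ (AdjoinRoot.root h₁) ∈ P ∧ AdjoinRoot.root h₂ ∈ P := by
  refine ⟨hP.mem_of_pow_mem 2 ?_, hP.mem_of_pow_mem 2 ?_⟩
  · rw [x_sq_eq k h₁ hh₁ h₂]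
    exact Ideal.mul_mem_right _ _ hy
  · rw [z_sq_eq k h₁ h₂ hh₂]
    exact P.neg_mem (Ideal.add_mem _ (Ideal.mul_mem_right _ _ (Ideal.mul_mem_right _ _ hy)) (Ideal.mul_mem_right _ _ hy))

/-- ★★ **Every prime `P ∋ ȳ` of `T₂` has a NON-FULL local ring `(T₂)_P`** (`P ⊇ (ȳ, x̄, z̄′) = 𝔮`; p640726's §3 at the point `P` of `Spec T₂`, via `Spec.stalkIso`).
[OURS · certificate] -/
theorem not_fullCl_localization_of_mem [CharP k 2] (h₁ : Polynomial (MvPolynomial (Fin 5) k)) (hh₁ : h₁ = Polynomial.X ^ 2 - Polynomial.C (X 0 * X 1))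
    (h₂ : Polynomial (AdjoinRoot h₁))
    (hh₂ : h₂ = Polynomial.X ^ 2 + (Polynomial.C (algebraMap (MvPolynomial (Fin 5) k) (AdjoinRoot h₁) (X 0 * X 1 ^ 2)) * Polynomial.X +
      Polynomial.C (algebraMap (MvPolynomial (Fin 5) k) (AdjoinRoot h₁) (X 0 * (1 + X 2 ^ 3 + X 3 ^ 3 + X 4 ^ 3)))))
    (P : Ideal (AdjoinRoot h₂)) [hP : P.IsPrime] (hy : algebraMap (MvPolynomial (Fin 5) k) (AdjoinRoot h₂) (X 0) ∈ P) :
    ¬ FullCl 2 (Localization.AtPrime P) := by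
  obtain ⟨κ, hκ⟩ := exists_killMap k h₁ hh₁ h₂ hh₂
  obtain ⟨hx, hz⟩ := mem_of_X0_mem k h₁ hh₁ h₂ hh₂ P hy
  intro hfull
  let w : Spec (.of (AdjoinRoot h₂)) := ⟨P, hP⟩
  exact TauFloorP2d5CYChartNotFull.not_fullCl_stalk_of_mem k h₁ hh₁ h₂ hh₂ κ hκ w hy hx hz
    (WFixAtNonClosedDimTwo.fullCl_of_ringEquiv 2 (Spec.stalkIso (.of _) w).commRingCatIsoToRingEquiv.symm hfull)

/-! ## §2 Every prime of `A₀[τ/ȳ]` over the vertex is NON-FULL -/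

set_option maxHeartbeats 800000 in
-- transport along the chart equivalence
/-- ★★ **Every prime `Q` of `A₀[τ/ȳ] = blowupAlgebra τ ȳ` with `𝔪_v ≤ Q ∩ A₀` has a NON-FULL local ring**: `Q` pulls back along `T₂ ≃+* blowupAlgebra τ ȳ` to a prime
containing `ȳ` (§1). [OURS · certificate; cite: Fedder1983, Prop. 1.7 (context)] -/
theorem not_fullCl_localization_blowupAlgebra_over [CharP k 2] (f : MvPolynomial (Fin 6) k) (hf : f = X 5 ^ 2 + X 0 ^ 4 * X 5 + X 1 ^ 3 + X 2 ^ 3 + X 3 ^ 3 + X 4 ^ 3)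
    (v : Spec (.of (MvPolynomial (Fin 6) k ⧸ Ideal.span {f})))
    (hv : v.asIdeal = Ideal.span (Set.range fun j : Fin 6 => Ideal.Quotient.mk (Ideal.span {f}) (X j)))
    (Q : Ideal (blowupAlgebra (Ideal.span {Ideal.Quotient.mk (Ideal.span {f}) (X 0) ^ 2, Ideal.Quotient.mk (Ideal.span {f}) (X 1), Ideal.Quotient.mk (Ideal.span {f}) (X 2), Ideal.Quotient.mk (Ideal.span {f}) (X 3), Ideal.Quotient.mk (Ideal.span {f}) (X 4), Ideal.Quotient.mk (Ideal.span {f}) (X 5)} :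
      Ideal (MvPolynomial (Fin 6) k ⧸ Ideal.span {f})) (Ideal.Quotient.mk (Ideal.span {f}) (X 1)))) [Q.IsPrime]
    (hQv : v.asIdeal ≤ Q.comap (algebraMap (MvPolynomial (Fin 6) k ⧸ Ideal.span {f}) _)) :
    ¬ FullCl 2 (Localization.AtPrime Q) := by
  classical
  let h₁ : Polynomial (MvPolynomial (Fin 5) k) := Polynomial.X ^ 2 - Polynomial.C (X 0 * X 1)
  let h₂ : Polynomial (AdjoinRoot h₁) := Polynomial.X ^ 2 + (Polynomial.C (algebraMap (MvPolynomial (Fin 5) k) (AdjoinRoot h₁) (X 0 * X 1 ^ 2)) * Polynomial.X +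
      Polynomial.C (algebraMap (MvPolynomial (Fin 5) k) (AdjoinRoot h₁) (X 0 * (1 + X 2 ^ 3 + X 3 ^ 3 + X 4 ^ 3))))
  obtain ⟨e, -, heX, -, -⟩ := TauFloorP2d5CYChartIdent.exists_chartEquiv k f hf h₁ rfl h₂ rfl
  haveI : (Q.comap e.toRingHom).IsPrime := Ideal.IsPrime.comap _
  have hy : algebraMap (MvPolynomial (Fin 5) k) (AdjoinRoot h₂) (X 0) ∈ Q.comap e.toRingHom := by
    rw [Ideal.mem_comap]
    have hval : e (algebraMap (MvPolynomial (Fin 5) k) (AdjoinRoot h₂) (X 0)) = algebraMap (MvPolynomial (Fin 6) k ⧸ Ideal.span {f}) _ (Ideal.Quotient.mk (Ideal.span {f}) (X 1)) := by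
      apply Subtype.ext
      rw [heX 0, Subalgebra.coe_algebraMap]
      rfl
    change e (algebraMap (MvPolynomial (Fin 5) k) (AdjoinRoot h₂) (X 0)) ∈ Q
    rw [hval]
    exact hQv (by rw [hv]; exact Ideal.subset_span ⟨1, rfl⟩)
  obtain ⟨eQ⟩ := E8Char5FiModel.nonempty_ringEquiv_localization_comap e Q
  exact fun hfull => not_fullCl_localization_of_mem k h₁ rfl h₂ rfl (Q.comap e.toRingHom) hy (WFixAtNonClosedDimTwo.fullCl_of_ringEquiv 2 eQ.symm hfull)

/-! ## §3 The charts `D(ū)`, `D(t̄)`, `D(s̄)` by the `S₄`-symmetry -/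

/-- The transposition automorphism `σ̄ = (X₁ ↔ X_j)` of `A₀` maps `𝔪_v` into itself. [plumbing] -/
theorem map_vertex_le_of_swap (f : MvPolynomial (Fin 6) k) (v : Spec (.of (MvPolynomial (Fin 6) k ⧸ Ideal.span {f})))
    (hv : v.asIdeal = Ideal.span (Set.range fun j : Fin 6 => Ideal.Quotient.mk (Ideal.span {f}) (X j))) (j : Fin 6)
    (σ : (MvPolynomial (Fin 6) k ⧸ Ideal.span {f}) ≃+* (MvPolynomial (Fin 6) k ⧸ Ideal.span {f}))
    (hσ : ∀ i : Fin 6, σ (Ideal.Quotient.mk (Ideal.span {f}) (X i)) = Ideal.Quotient.mk (Ideal.span {f}) (X (Equiv.swap 1 j i))) :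
    ∀ r ∈ v.asIdeal, σ r ∈ v.asIdeal := by
  have hmap : v.asIdeal.map σ.toRingHom ≤ v.asIdeal := by
    rw [hv, Ideal.map_span, Ideal.span_le]
    rintro _ ⟨_, ⟨i, rfl⟩, rfl⟩
    change σ (Ideal.Quotient.mk (Ideal.span {f}) (X i)) ∈ _
    rw [hσ i]
    exact Ideal.subset_span ⟨Equiv.swap 1 j i, rfl⟩
  intro r hr
  exact hmap (Ideal.mem_map_of_mem σ.toRingHom hr)

set_option maxHeartbeats 800000 in
-- one symmetry transport
/-- ★★ **Charts `D(x̄_j)`, `j ∈ {2,3,4}` (= `D(ū)`, `D(t̄)`, `D(s̄)`): every prime `Q` of `A₀[τ/x̄_j]` with `𝔪_v ≤ Q ∩ A₀` has a NON-FULL local ring** — pulled back along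
`A₀[τ/ȳ] ≃+* A₀[τ/x̄_j]` over `σ̄ = (X₁ ↔ X_j)` (`σ̄(𝔪_v) ⊆ 𝔪_v`) to §2. [OURS · certificate] -/
theorem not_fullCl_localization_blowupAlgebra_over_of_swap [CharP k 2] (f : MvPolynomial (Fin 6) k) (hf : f = X 5 ^ 2 + X 0 ^ 4 * X 5 + X 1 ^ 3 + X 2 ^ 3 + X 3 ^ 3 + X 4 ^ 3)
    (v : Spec (.of (MvPolynomial (Fin 6) k ⧸ Ideal.span {f})))
    (hv : v.asIdeal = Ideal.span (Set.range fun j : Fin 6 => Ideal.Quotient.mk (Ideal.span {f}) (X j))) (j : Fin 6) (hj : j = 2 ∨ j = 3 ∨ j = 4)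
    (Q : Ideal (blowupAlgebra (Ideal.span {Ideal.Quotient.mk (Ideal.span {f}) (X 0) ^ 2, Ideal.Quotient.mk (Ideal.span {f}) (X 1), Ideal.Quotient.mk (Ideal.span {f}) (X 2), Ideal.Quotient.mk (Ideal.span {f}) (X 3), Ideal.Quotient.mk (Ideal.span {f}) (X 4), Ideal.Quotient.mk (Ideal.span {f}) (X 5)} :
      Ideal (MvPolynomial (Fin 6) k ⧸ Ideal.span {f})) (Ideal.Quotient.mk (Ideal.span {f}) (X j)))) [Q.IsPrime]
    (hQv : v.asIdeal ≤ Q.comap (algebraMap (MvPolynomial (Fin 6) k ⧸ Ideal.span {f}) _)) :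
    ¬ FullCl 2 (Localization.AtPrime Q) := by
  classical
  obtain ⟨σ, hσX, hτ, hy⟩ := TauFloorP2d5CChartSymmetry.exists_swap_auto k f hf j hj
  obtain ⟨E₀, hE₀⟩ := TauFloorOneChartSymmetry.exists_blowupAlgebra_congr' σ _ _ hτ _ _ hy
  haveI : (Q.comap E₀.toRingHom).IsPrime := Ideal.IsPrime.comap _
  have hPv : v.asIdeal ≤ (Q.comap E₀.toRingHom).comap (algebraMap (MvPolynomial (Fin 6) k ⧸ Ideal.span {f}) _) := by
    intro r hr
    rw [Ideal.mem_comap, Ideal.mem_comap]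
    change E₀ (algebraMap _ _ r) ∈ Q
    rw [hE₀ r]
    exact hQv (map_vertex_le_of_swap k f v hv j σ hσX r hr)
  exact LocalBlowupBadFibreFromCharts.not_fullCl_localization_of_ringEquiv 2 E₀ (Q.comap E₀.toRingHom) Q rfl
    (not_fullCl_localization_blowupAlgebra_over k f hf v hv (Q.comap E₀.toRingHom) hPv)

end Summit.ResolutionOfSingularities.ResolutionOfSingularities.Theorems.FInjectiveMacaulayfication.TauFloorP2d5CYChartBadFibre

end
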